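/-
Copyright (c) 2026. All rights reserved.
Released under Apache 2.0 license as described in the file LICENSE.
-/
import Literature.AlgebraicGeometry.Pohlmann1968.MultiquadraticCMFieldSimpleExceptionalClasses
import HarnessLib

/-!
# Multiquadratic CM fields of degree `32`: an abelian variety carries an exceptional Hodge class iff its CM type has
# rank `11`

SETTING (tree `MultiquadraticCMFieldDegreeThirtyTwoRankSpectrum`, `MultiquadraticCMFieldSimpleExceptionalClasses`).
`K` a CM field, Galois over `ℚ` with `Gal(K/ℚ)` of exponent `2` and `[K:ℚ] = 32`, `Φ` any CM type, `A` any abelian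
variety (`dim A = 16`) of type `(K; Φ)`.  The tree knows: `Rank(Φ) ∈ {2, 5, 9, 11, 17}`; `A` simple iff
`Rank(Φ) ∈ {11, 17}`; `Rank(Φ) ≠ 11 ⟹ Bᵐ(Aⁿ) ⊗ ℂ = Dᵐ(Aⁿ) ⊗ ℂ` for all `n, m` (g38); simple + degenerate ⟹ an
exceptional Hodge class ON `A` (S. P. White's theorem, g39-#10).  Assembled, the degree-`32` picture closes in one
line:

> **Theorem** (`exists_exceptional_iff_cmTypeRank_eq_eleven`).  `A` carries an exceptional Hodge class — a rational
> `(m,m)`-class outside `Dᵐ(A) ⊗ ℂ` for some `m` — **iff `Rank(Φ) = 11`**; equivalently iff `A` is simple of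
> degenerate type (`exists_exceptional_iff_isSimple_and_not_isNondegenerate`); and `Bᵐ(A) ⊗ ℂ = Dᵐ(A) ⊗ ℂ` for all
> `m` iff `Rank(Φ) ≠ 11` (`forall_hodgeClassSpan_eq_iff_cmTypeRank_ne_eleven`).

* `forall_hodgeClassSpan_eq_of_cmTypeRank_ne_eleven` (`B = D` on `A` itself), **`exists_exceptional_iff_cmTypeRank_eq_eleven`**,
  `forall_hodgeClassSpan_eq_iff_cmTypeRank_ne_eleven`, `exists_exceptional_iff_isSimple_and_not_isNondegenerate`.

HONEST SCOPE.  Assembly only; the Hodge conjecture for the rank-`11` (simple, degenerate) `16`-folds is open and not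
addressed.  THEOREMS ONLY: no definition, no named fact, no instance, no `sorry`.

## References

* [White1993SporadicCycles] S. P. White, *Sporadic cycles on CM abelian varieties*, Compositio Math. 88 (1993), §4 Thm. 3.
* [Gordon1999HodgeAVSurvey] B. B. Gordon, *A survey of the Hodge conjecture for abelian varieties*, Thm. 6.4, §9.2–9.3.
* [Kubota1965] T. Kubota, *On the field extension by complex multiplication*, Trans. AMS 118 (1965), §2, §4 Lemma 2.
* [Dodson1984] B. Dodson, *The structure of Galois groups of CM-fields*, Trans. AMS 283 (1984), §3.2.1, §3.3.2.

## Provenance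

Lane `lit-hodgefound` (Track 2, Layer A5), seat `lit-hodgefound-p10` generation 39, row g39-#14; neighbours cited by
name, nothing restated: `MultiquadraticCMFieldDegreeThirtyTwoRankSpectrum` (g38-#10:
`isSimple_iff_cmTypeRank_eq_eleven_or_seventeen`, `hodgeClassSpan_pow_eq_divisorClassesSpan_of_cmTypeRank_ne_eleven`),
`MultiquadraticCMFieldSimpleExceptionalClasses` (g39-#10: `exceptional_self_of_isSimple_not_isNondegenerate`),
`NonSimpleCMAbelianVarietyHazamaCriterion` (`forall_pow_hodgeClassSpan_eq_iff_forall_hodgeClassSpan_eq`),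
`NondegenerateCMTypeDivisorClasses` (`isNondegenerate_iff`).
-/

open scoped BigOperators NumberField IsMulCommutative Classical
open NumberField Module CategoryTheory CategoryTheory.Limits IntermediateField

namespace Literature.AlgebraicGeometry.Pohlmann1968

namespace Multiquadratic

open scoped Literature.NumberTheory.ComplexMultiplication
open Literature.AlgebraicGeometry.Motives (CMType AbelianVariety)
open Literature.AlgebraicGeometry.HodgeTheory
open Literature.AlgebraicGeometry.VanGeemen1994 (hodgeClassSpan)
open Literature.Barriers.HodgeConjecture (divisorClassesSpan)
open Literature.AlgebraicGeometry.ComplexMultiplication (IsCMTypeRealisation)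

variable {K : Type} [Field K] [NumberField K] [IsCMField K] [IsGalois ℚ K]
  {A : AbelianVariety ℂ} {ι : 𝓞 K →+* End A} {θ : K →+* Module.End ℂ (complexBetti A.X 1)}

/-- **`[K:ℚ] = 32`, `Rank(Φ) ≠ 11` ⟹ `Bᵐ(A) ⊗ ℂ = Dᵐ(A) ⊗ ℂ` for all `m`** — on `A` itself (the tree's all-powers
theorem, read back on `A` through «all powers iff `A`» for the abelian field `K`).
[cite: Gordon1999HodgeAVSurvey, Thm. 6.4 and §9.3] [cite: White1993SporadicCycles, §4 Theorem 3] -/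
theorem forall_hodgeClassSpan_eq_of_cmTypeRank_ne_eleven (hexp : ∀ g : K ≃ₐ[ℚ] K, g ^ 2 = 1)
    (h32 : finrank ℚ K = 32) (Φ : CMType K) (h11 : cmTypeRank Φ ≠ 11) (hA : IsCMTypeRealisation Φ A ι θ) (m : ℕ) :
    hodgeClassSpan (finrank ℚ K / 2) A.X m = divisorClassesSpan A.X (finrank ℚ K / 2) m := by
  haveI := isAbelianGalois_of_forall_sq_eq_one hexp
  exact (forall_pow_hodgeClassSpan_eq_iff_forall_hodgeClassSpan_eq hA).1
    (hodgeClassSpan_pow_eq_divisorClassesSpan_of_cmTypeRank_ne_eleven hexp h32 Φ h11 hA) m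

/-- **`[K:ℚ] = 32`: `A` CARRIES AN EXCEPTIONAL HODGE CLASS IFF `Rank(Φ) = 11`** (`⟸`: rank `11` means simple and
degenerate, White's theorem; `⟹`: every other rank has `B = D` on `A`). [cite: White1993SporadicCycles, §4 Theorem 3]
[cite: Gordon1999HodgeAVSurvey, Thm. 6.4, §9.2–9.3] [cite: Kubota1965, §2] -/
theorem exists_exceptional_iff_cmTypeRank_eq_eleven (hexp : ∀ g : K ≃ₐ[ℚ] K, g ^ 2 = 1) (h32 : finrank ℚ K = 32)
    (Φ : CMType K) (hA : IsCMTypeRealisation Φ A ι θ) :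
    (∃ m : ℕ, ∃ c : complexBetti A.X (2 * m), IsRationalClass c ∧
        IsOfHodgeType (finrank ℚ K / 2) A.X (2 * m) m m c ∧ c ∉ divisorClassesSpan A.X (finrank ℚ K / 2) m) ↔
      cmTypeRank Φ = 11 := by
  constructor
  · rintro ⟨m, c, hcQ, hcH, hcD⟩
    by_contra h11
    exact hcD ((forall_hodgeClassSpan_eq_of_cmTypeRank_ne_eleven hexp h32 Φ h11 hA m) ▸
      Submodule.subset_span ⟨hcQ, hcH⟩)
  · intro h11
    have hS : A.IsSimple := (isSimple_iff_cmTypeRank_eq_eleven_or_seventeen hexp h32 Φ hA).2 (Or.inl h11)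
    have hnd : ¬ IsNondegenerate Φ := by
      rw [isNondegenerate_iff, h32, h11]
      norm_num
    exact exceptional_self_of_isSimple_not_isNondegenerate hexp hA hS hnd

/-- **`[K:ℚ] = 32`: `Bᵐ(A) ⊗ ℂ = Dᵐ(A) ⊗ ℂ` for all `m` iff `Rank(Φ) ≠ 11`.** [cite: Gordon1999HodgeAVSurvey, Thm. 6.4, §9.2–9.3]
[cite: White1993SporadicCycles, §4 Theorem 3] -/
theorem forall_hodgeClassSpan_eq_iff_cmTypeRank_ne_eleven (hexp : ∀ g : K ≃ₐ[ℚ] K, g ^ 2 = 1)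
    (h32 : finrank ℚ K = 32) (Φ : CMType K) (hA : IsCMTypeRealisation Φ A ι θ) :
    (∀ m : ℕ, hodgeClassSpan (finrank ℚ K / 2) A.X m = divisorClassesSpan A.X (finrank ℚ K / 2) m) ↔
      cmTypeRank Φ ≠ 11 := by
  refine ⟨fun h h11 => ?_, fun h11 m => forall_hodgeClassSpan_eq_of_cmTypeRank_ne_eleven hexp h32 Φ h11 hA m⟩
  obtain ⟨m, c, hcQ, hcH, hcD⟩ := (exists_exceptional_iff_cmTypeRank_eq_eleven hexp h32 Φ hA).2 h11
  exact hcD ((h m) ▸ Submodule.subset_span ⟨hcQ, hcH⟩)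

/-- **`[K:ℚ] = 32`: `A` carries an exceptional Hodge class iff `A` is SIMPLE of DEGENERATE type.**
[cite: White1993SporadicCycles, §4 Theorem 3] [cite: Dodson1984, §3.2.1 and §3.3.2] [cite: Gordon1999HodgeAVSurvey, §9.2] -/
theorem exists_exceptional_iff_isSimple_and_not_isNondegenerate (hexp : ∀ g : K ≃ₐ[ℚ] K, g ^ 2 = 1)
    (h32 : finrank ℚ K = 32) (Φ : CMType K) (hA : IsCMTypeRealisation Φ A ι θ) :
    (∃ m : ℕ, ∃ c : complexBetti A.X (2 * m), IsRationalClass c ∧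
        IsOfHodgeType (finrank ℚ K / 2) A.X (2 * m) m m c ∧ c ∉ divisorClassesSpan A.X (finrank ℚ K / 2) m) ↔
      A.IsSimple ∧ ¬ IsNondegenerate Φ := by
  rw [exists_exceptional_iff_cmTypeRank_eq_eleven hexp h32 Φ hA, isSimple_iff_cmTypeRank_eq_eleven_or_seventeen hexp h32 Φ hA,
    isNondegenerate_iff, h32]
  norm_num
  omega

end Multiquadratic

end Literature.AlgebraicGeometry.Pohlmann1968
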